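import Mathlib.FieldTheory.Galois.Basic
import Mathlib.RingTheory.TensorProduct.Basic
import Mathlib.RingTheory.IsTensorProduct
import Mathlib.LinearAlgebra.DirectSum.Finsupp
import Mathlib.LinearAlgebra.Dimension.OrzechProperty
import Literature.RingTheory.GaloisAlgebras.SpeiserLemma
import HarnessLib

/-!
# Galois descent for algebras: `L ⊗_k A^Γ ≅ A` for a semilinear Galois action (Speiser's lemma,
# both halves)

Let `L / k` be a finite Galois extension with group `Γ = Gal(L/k) = L ≃ₐ[k] L`, and let `A` be a
(commutative) `L`-algebra on which `Γ` acts by ring endomorphisms `τ σ` **semilinearly**: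
`τ σ (l · a) = σ(l) · τ σ a`, i.e. `τ σ ∘ algebraMap L A = algebraMap L A ∘ σ`. Then the
invariants `A^Γ = {a ; τ σ a = a ∀ σ}` form a `k`-subalgebra (`invariants`) and the multiplication
map `μ : L ⊗_k A^Γ → A`, `l ⊗ a ↦ l · a`, is an **isomorphism of `L`-algebras** — Speiser's lemma,
alias Galois descent for vector spaces / algebras (Serre, *Local Fields*, Ch. X, §1, Prop. 3 with
Lemma 1 of §2; Bourbaki, *Algebra* II, Ch. V, §10, no. 4, Prop. 6; Görtz–Wedhorn I, Thm. 14.83 /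
Cor. 14.85, the affine case of Galois descent of schemes):

* `mul_invariants_surjective` — **surjectivity**: every `a ∈ A` is an `L`-combination of invariants;
  this is the tree's `Literature.RingTheory.GaloisAlgebras.mem_span_fixedPoints`
  (`…GaloisAlgebras.SpeiserLemma`, Cartier's Poincaré-series argument), repackaged.
* `exists_sum_smul_mul_eq_ite`, `eq_zero_of_sum_smul_eq_zero` — **injectivity**: for a `k`-basis
  `(b_j)` of `L` the square matrix `(σ(b_j))_{σ, j}` is invertible (its columns `σ ↦ σ(b_j)` span
  all functions `Γ → L` by Dedekind–Artin, `span_range_smul_eq_top`, and `|Γ| = [L : k]`,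
  Mathlib `IsGalois.card_aut_eq_finrank`), so from `∑ⱼ b_j · a_j = 0` with invariant `a_j` one
  gets `a_{j₀} = ∑_σ d_σ · τ σ (∑ⱼ b_j a_j) = 0` (Serre, loc. cit., proof of Lemma 1 of §2 /
  Bourbaki, loc. cit.).
* `mulInvariants`, `mulInvariants_bijective`, **`descentEquiv : L ⊗[k] A^Γ ≃ₐ[L] A`**, and the
  pushout form **`isPushout_of_invariants`**: for any `k`-algebra `B` mapping injectively onto the
  invariants, `Algebra.IsPushout k L B A` (`A = L ⊗_k B`), the input of
  Mathlib's `CommRingCat.isPushout_of_isPushout` / `AlgebraicGeometry.isPullback_SpecMap_of_isPushout`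
  (used for Galois descent of quasi-projective schemes, `Motives/GaloisDescentScheme`).

Everything is proved; no named facts (D-0026).

Mathlib searched (pin): `linearIndependent_monoidHom` (Dedekind, used through the tree's
`span_range_smul_eq_top`), `IsGalois.card_aut_eq_finrank`,
`linearIndependent_of_top_le_span_of_card_eq_finrank`, `TensorProduct.finsuppScalarLeft`,
`IsBaseChange.of_equiv`, `Algebra.IsPushout` (all used); Mathlib has Hilbert 90
(`groupCohomology.Hilbert90`) but no Speiser lemma / Galois descent of vector spaces or algebras.

## References

* J.-P. Serre, *Local Fields*, GTM 67, Springer (1979): Ch. X, §1, Prop. 3 and §2, Lemma 1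
  ("Let `V` be an `L`-vector space with a semilinear action of `G` … `V^G ⊗_k L → V` is an
  isomorphism"). [SerreLocalFields1979]
* U. Görtz, T. Wedhorn, *Algebraic Geometry I: Schemes*, 2nd ed. (2020): Thm. 14.83, Cor. 14.85
  (Galois descent, affine case). [GortzWedhorn2020]
-/

noncomputable section

open scoped TensorProduct BigOperators

namespace Literature.RingTheory.GaloisAlgebras

namespace GaloisDescentAlgebras

variable {k L : Type*} [Field k] [Field L] [Algebra k L]
variable {A : Type*} [CommRing A] [Algebra k A] [Algebra L A] [IsScalarTower k L A]
variable (τ : (L ≃ₐ[k] L) →* (A →+* A))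

/-! ### Semilinear actions and their invariants -/

/-- The action `τ` of `Gal(L/k)` on the `L`-algebra `A` is **semilinear**: `τ σ (l · 1) = σ(l) · 1`,
whence `τ σ (l · a) = σ(l) · τ σ a` (Serre, *Local Fields*, Ch. X, §2: "`s(λ x) = s(λ) s(x)`").
[cite: SerreLocalFields1979, Ch. X, §2 (semilinear actions)] -/
structure IsSemilinear : Prop where
  /-- `τ σ ∘ algebraMap L A = algebraMap L A ∘ σ`. -/
  apply_algebraMap : ∀ (σ : L ≃ₐ[k] L) (l : L), τ σ (algebraMap L A l) = algebraMap L A (σ l)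

variable {τ}

omit [Algebra k A] [IsScalarTower k L A] in
/-- `τ σ (l • a) = σ l • τ σ a`. [cite: SerreLocalFields1979, Ch. X, §2] -/
theorem IsSemilinear.map_smul (hτ : IsSemilinear τ) (σ : L ≃ₐ[k] L) (l : L) (a : A) :
    τ σ (l • a) = σ l • τ σ a := by
  rw [Algebra.smul_def, Algebra.smul_def, map_mul, hτ.apply_algebraMap]

/-- A semilinear action fixes `k`: `τ σ (c · 1) = c · 1` for `c ∈ k`. [cite: SerreLocalFields1979, Ch. X, §2] -/
theorem IsSemilinear.map_algebraMap (hτ : IsSemilinear τ) (σ : L ≃ₐ[k] L) (c : k) :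
    τ σ (algebraMap k A c) = algebraMap k A c := by
  rw [IsScalarTower.algebraMap_apply k L A, hτ.apply_algebraMap, AlgEquiv.commutes]

variable (τ) in
/-- The **subring of invariants** `A^Γ = {a ; τ σ a = a ∀ σ}`. [cite: SerreLocalFields1979, Ch. X, §2 (V^G)] -/
def invariantsSubring : Subring A where
  carrier := {a | ∀ σ, τ σ a = a}
  mul_mem' ha hb σ := by rw [map_mul, ha σ, hb σ]
  one_mem' σ := map_one _
  add_mem' ha hb σ := by rw [map_add, ha σ, hb σ]
  zero_mem' σ := map_zero _
  neg_mem' ha σ := by rw [map_neg, ha σ]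

omit [Algebra k A] [Algebra L A] [IsScalarTower k L A] in
/-- Membership in `A^Γ`. [folklore] -/
@[simp]
theorem mem_invariantsSubring {a : A} : a ∈ invariantsSubring τ ↔ ∀ σ, τ σ a = a := Iff.rfl

/-- The **`k`-subalgebra of invariants** `A^Γ` of a semilinear action (it contains `k` by
`IsSemilinear.map_algebraMap`). [cite: SerreLocalFields1979, Ch. X, §2 (V^G is a k-structure)] -/
def invariants (hτ : IsSemilinear τ) : Subalgebra k A :=
  { (invariantsSubring τ).toSubsemiring with
    algebraMap_mem' := fun c σ ↦ hτ.map_algebraMap σ c }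

/-- Membership in `A^Γ`. [folklore] -/
@[simp]
theorem mem_invariants (hτ : IsSemilinear τ) {a : A} : a ∈ invariants hτ ↔ ∀ σ, τ σ a = a :=
  Iff.rfl

/-! ### Surjectivity: `A` is spanned over `L` by its invariants (Speiser, Cartier) -/

/-- The additive action underlying `τ`, as a homomorphism into `AddMonoid.End A` (the shape used by
`mem_span_fixedPoints`). [folklore] -/
def toAddMonoidEnd : (L ≃ₐ[k] L) →* AddMonoid.End A where
  toFun σ := (τ σ).toAddMonoidHom
  map_one' := by
    ext a
    change τ 1 a = a
    rw [map_one, RingHom.one_def, RingHom.id_apply]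
  map_mul' σ σ' := by
    ext a
    change τ (σ * σ') a = τ σ (τ σ' a)
    rw [map_mul, RingHom.mul_def, RingHom.comp_apply]

omit [Algebra k A] [Algebra L A] [IsScalarTower k L A] in
/-- Unfolding `toAddMonoidEnd`. [folklore] -/
@[simp]
theorem toAddMonoidEnd_apply (σ : L ≃ₐ[k] L) (a : A) : toAddMonoidEnd (τ := τ) σ a = τ σ a := rfl

/-- **Speiser, surjectivity half**: every element of `A` is an `L`-linear combination of
`Γ`-invariants (the tree's `mem_span_fixedPoints`, Serre, *Local Fields*, X §1 Prop. 3, applied to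
the semilinear additive action `toAddMonoidEnd`). [cite: SerreLocalFields1979, Ch. X, §1, Prop. 3] -/
theorem mem_span_invariants [FiniteDimensional k L] (hτ : IsSemilinear τ) (a : A) :
    a ∈ Submodule.span L ((invariants hτ : Set A)) := by
  classical
  have h := mem_span_fixedPoints (Γ := L ≃ₐ[k] L) (E := L) (V := A) (toAddMonoidEnd (τ := τ))
    (fun σ l v ↦ by rw [toAddMonoidEnd_apply, hτ.map_smul]; rfl) a
  have hset : {w : A | ∀ s : L ≃ₐ[k] L, toAddMonoidEnd (τ := τ) s w = w} = (invariants hτ : Set A) := by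
    ext w
    simp only [Set.mem_setOf_eq, toAddMonoidEnd_apply, SetLike.mem_coe, mem_invariants]
  rwa [hset] at h

/-! ### Injectivity: the matrix `(σ(b_j))` is invertible (Dedekind–Artin) -/

section Dedekind

variable (k L)
variable [FiniteDimensional k L] [IsGalois k L]

omit [IsGalois k L] in
/-- For a `k`-basis `b` of `L`, the functions `σ ↦ σ(b j)` on `Γ = Gal(L/k)` **span** the `L`-space
of all functions `Γ → L`: every `σ ↦ σ(e)` is a `k`-combination of them, and those span by
Dedekind–Artin (`span_range_smul_eq_top`). [cite: SerreLocalFields1979, Ch. X, §1, Prop. 3 (proof)] -/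
theorem top_le_span_range_apply_basis {ι : Type*} (b : Module.Basis ι k L) :
    ⊤ ≤ Submodule.span L (Set.range fun j : ι ↦ fun σ : L ≃ₐ[k] L ↦ σ (b j)) := by
  classical
  rw [← span_range_smul_eq_top (L ≃ₐ[k] L) L, Submodule.span_le]
  rintro _ ⟨e, rfl⟩
  show (fun σ : L ≃ₐ[k] L ↦ σ • e) ∈
    (Submodule.span L (Set.range fun j : ι ↦ fun σ : L ≃ₐ[k] L ↦ σ (b j)) : Set _)
  -- `σ ↦ σ e = ∑_j (b.repr e j) • (σ ↦ σ (b j))`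
  have he : (fun σ : L ≃ₐ[k] L ↦ σ • e) =
      ∑ j ∈ (b.repr e).support, algebraMap k L (b.repr e j) • fun σ : L ≃ₐ[k] L ↦ σ (b j) := by
    ext σ
    simp only [Finset.sum_apply, Pi.smul_apply, smul_eq_mul, AlgEquiv.smul_def]
    conv_lhs => rw [← b.linearCombination_repr e, Finsupp.linearCombination_apply, Finsupp.sum,
      map_sum]
    refine Finset.sum_congr rfl fun j _ ↦ ?_
    rw [map_smul, Algebra.smul_def]
  rw [SetLike.mem_coe, he]
  exact Submodule.sum_mem _ fun j _ ↦ Submodule.smul_mem _ _ (Submodule.subset_span ⟨j, rfl⟩)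

/-- For a finite `k`-basis `b` of `L`, the functions `σ ↦ σ(b j)` form a **basis** of the functions
`Γ → L` (they span, and `|Γ| = [L : k]` by Mathlib `IsGalois.card_aut_eq_finrank`): the matrix
`(σ(b_j))_{σ,j}` is invertible (Dedekind–Artin). [cite: SerreLocalFields1979, Ch. X, §1, Prop. 3 (proof)] -/
theorem linearIndependent_apply_basis {ι : Type*} [Fintype ι] (b : Module.Basis ι k L) :
    LinearIndependent L (fun j : ι ↦ fun σ : L ≃ₐ[k] L ↦ σ (b j)) := by
  classical
  refine linearIndependent_of_top_le_span_of_card_eq_finrank (top_le_span_range_apply_basis k L b) ?_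
  rw [Module.finrank_fintype_fun_eq_card, ← Module.finrank_eq_card_basis b,
    ← IsGalois.card_aut_eq_finrank k L, Nat.card_eq_fintype_card]

/-- The basis `(σ ↦ σ(b j))_j` of the `L`-space of functions `Gal(L/k) → L`. [cite: SerreLocalFields1979, Ch. X, §1, Prop. 3 (proof)] -/
def applyBasis {ι : Type*} [Fintype ι] (b : Module.Basis ι k L) :
    Module.Basis ι L ((L ≃ₐ[k] L) → L) :=
  Module.Basis.mk (linearIndependent_apply_basis k L b) (top_le_span_range_apply_basis k L b)

/-- Unfolding `applyBasis`. [folklore] -/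
@[simp]
theorem applyBasis_apply {ι : Type*} [Fintype ι] (b : Module.Basis ι k L) (j : ι) :
    applyBasis k L b j = fun σ : L ≃ₐ[k] L ↦ σ (b j) :=
  Module.Basis.mk_apply _ _ _

/-- **The inverse matrix**: for a finite `k`-basis `b` of `L` and an index `j₀` there are `d_σ ∈ L`
with `∑_σ d_σ σ(b j) = δ_{j, j₀}` for all `j` (row `j₀` of the inverse of `(σ(b_j))`; here
`d_σ` is the `j₀`-th coordinate of the delta function at `σ`). [cite: SerreLocalFields1979, Ch. X, §2, Lemma 1 (proof)] -/
theorem exists_sum_smul_mul_eq_ite {ι : Type*} [Fintype ι] [DecidableEq ι] (b : Module.Basis ι k L)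
    (j₀ : ι) :
    ∃ d : (L ≃ₐ[k] L) → L, ∀ j, ∑ σ, d σ * σ (b j) = if j = j₀ then 1 else 0 := by
  classical
  let B := applyBasis k L b
  refine ⟨fun σ ↦ B.coord j₀ (Pi.single σ 1), fun j ↦ ?_⟩
  -- any function is `∑_σ h σ • δ_σ`, so a linear form `φ` is `h ↦ ∑_σ h σ * φ δ_σ`
  have hφ : ∀ h : (L ≃ₐ[k] L) → L, B.coord j₀ h = ∑ σ, B.coord j₀ (Pi.single σ 1) * h σ := by
    intro h
    conv_lhs => rw [show h = ∑ σ, h σ • (Pi.single σ (1 : L) : (L ≃ₐ[k] L) → L) from by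
      ext σ'; simp [Finset.sum_apply, Pi.single_apply]]
    rw [map_sum]
    exact Finset.sum_congr rfl fun σ _ ↦ by rw [map_smul, smul_eq_mul, mul_comm]
  have hj : B.coord j₀ (B j) = if j = j₀ then 1 else 0 := by
    rw [Module.Basis.coord_apply, B.repr_self, Finsupp.single_apply]
  rw [← hj, hφ (B j)]
  refine Finset.sum_congr rfl fun σ _ ↦ ?_
  rw [show (B j) σ = σ (b j) by simp [B]]

end Dedekind

/-! ### The multiplication map and the descent isomorphism -/

/-- **The multiplication map `μ : L ⊗_k A^Γ → A`**, `l ⊗ a ↦ l · a`, an `L`-algebra homomorphism.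
[cite: SerreLocalFields1979, Ch. X, §2, Lemma 1] -/
def mulInvariants (hτ : IsSemilinear τ) : L ⊗[k] (invariants hτ) →ₐ[L] A :=
  Algebra.TensorProduct.lift (Algebra.ofId L A) (invariants hτ).val (fun _ _ ↦ Commute.all _ _)

/-- `μ (l ⊗ a) = l · a`. [folklore] -/
@[simp]
theorem mulInvariants_tmul (hτ : IsSemilinear τ) (l : L) (a : invariants hτ) :
    mulInvariants hτ (l ⊗ₜ a) = l • (a : A) := by
  simp [mulInvariants, Algebra.TensorProduct.lift_tmul, Algebra.ofId_apply, Algebra.smul_def]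

variable [FiniteDimensional k L] [IsGalois k L]


omit [Algebra k A] [IsScalarTower k L A] in
/-- **Speiser, injectivity half (in coordinates).** If `∑ⱼ b_j · a_j = 0` in `A` for a finite
`k`-basis `(b_j)` of `L` and *invariant* `a_j`, then all `a_j = 0`: with `∑_σ d_σ σ(b_j) = δ_{j,j₀}`
(`exists_sum_smul_mul_eq_ite`), `a_{j₀} = ∑_σ d_σ · τ σ (∑ⱼ b_j a_j) = 0`
(Serre, *Local Fields*, X §2, Lemma 1; Bourbaki, *Algebra* II, V §10 no. 4 Prop. 6).
[cite: SerreLocalFields1979, Ch. X, §2, Lemma 1] -/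
theorem eq_zero_of_sum_smul_eq_zero (hτ : IsSemilinear τ) {ι : Type*} [Fintype ι]
    (b : Module.Basis ι k L) (a : ι → A) (ha : ∀ j σ, τ σ (a j) = a j)
    (h0 : ∑ j, b j • a j = 0) (j₀ : ι) : a j₀ = 0 := by
  classical
  obtain ⟨d, hd⟩ := exists_sum_smul_mul_eq_ite k L b j₀
  -- apply `τ σ` to the relation: `∑_j σ(b_j) • a_j = 0`
  have hσ : ∀ σ : L ≃ₐ[k] L, ∑ j, σ (b j) • a j = 0 := fun σ ↦ by
    have := congrArg (τ σ) h0
    rw [map_sum, map_zero] at this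
    simpa only [hτ.map_smul, ha] using this
  calc a j₀ = ∑ j, (if j = j₀ then (1 : L) else 0) • a j := by
          simp [ite_smul, Finset.sum_ite_eq']
    _ = ∑ j, (∑ σ, d σ * σ (b j)) • a j := Finset.sum_congr rfl fun j _ ↦ by rw [hd j]
    _ = ∑ σ, d σ • ∑ j, σ (b j) • a j := by
          simp only [Finset.sum_smul, Finset.smul_sum, smul_smul]
          exact Finset.sum_comm
    _ = 0 := by simp [hσ]

omit [IsGalois k L] in
/-- **`μ` is surjective** (`mem_span_invariants`). [cite: SerreLocalFields1979, Ch. X, §1, Prop. 3] -/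
theorem mulInvariants_surjective (hτ : IsSemilinear τ) : Function.Surjective (mulInvariants hτ) := by
  intro a
  have ha := mem_span_invariants hτ a
  refine Submodule.span_induction (p := fun a _ ↦ ∃ z, mulInvariants hτ z = a) ?_ ?_ ?_ ?_ ha
  · rintro w hw
    exact ⟨1 ⊗ₜ ⟨w, hw⟩, by simp⟩
  · exact ⟨0, map_zero _⟩
  · rintro x y - - ⟨zx, rfl⟩ ⟨zy, rfl⟩
    exact ⟨zx + zy, map_add _ _ _⟩
  · rintro l x - ⟨z, rfl⟩
    exact ⟨l • z, by rw [map_smul]⟩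

/-- **`μ` is injective**: write `z = ∑ⱼ b_j ⊗ a_j` in a `k`-basis `(b_j)` of `L`
(`TensorProduct.finsuppScalarLeft`) and apply `eq_zero_of_sum_smul_eq_zero`.
[cite: SerreLocalFields1979, Ch. X, §2, Lemma 1] -/
theorem mulInvariants_injective (hτ : IsSemilinear τ) : Function.Injective (mulInvariants hτ) := by
  classical
  rw [injective_iff_map_eq_zero]
  intro z hz
  let ι := Module.Basis.ofVectorSpaceIndex k L
  let b : Module.Basis ι k L := Module.Basis.ofVectorSpace k L
  -- coordinates of `z` along the basis `b ⊗ 1`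
  let φ : L ⊗[k] (invariants hτ) ≃ₗ[k] (ι →₀ invariants hτ) :=
    (TensorProduct.congr b.repr (LinearEquiv.refl k _)).trans
      (TensorProduct.finsuppScalarLeft k (invariants hτ) ι)
  have hφ : ∀ (j : ι) (a : invariants hτ), φ.symm (Finsupp.single j a) = b j ⊗ₜ a := by
    intro j a
    rw [LinearEquiv.symm_apply_eq]
    simp [φ, TensorProduct.finsuppScalarLeft_apply_tmul]
  -- `z = ∑_j b_j ⊗ (φ z j)`
  have hz' : z = ∑ j, b j ⊗ₜ (φ z j : invariants hτ) := by
    conv_lhs => rw [← φ.symm_apply_apply z, ← Finsupp.sum_single (φ z), Finsupp.sum_fintype _ _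
      (fun _ ↦ Finsupp.single_zero _), map_sum]
    exact Finset.sum_congr rfl fun j _ ↦ hφ j _
  have hsum : ∑ j, b j • ((φ z j : invariants hτ) : A) = 0 := by
    have := congrArg (mulInvariants hτ) hz'
    rw [hz, map_sum] at this
    simpa only [mulInvariants_tmul] using this.symm
  have hall : ∀ j, ((φ z j : invariants hτ) : A) = 0 :=
    eq_zero_of_sum_smul_eq_zero hτ b (fun j ↦ ((φ z j : invariants hτ) : A))
      (fun j σ ↦ (φ z j).2 σ) hsum
  rw [hz']
  refine Finset.sum_eq_zero fun j _ ↦ ?_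
  rw [show (φ z j : invariants hτ) = 0 from Subtype.ext (hall j), TensorProduct.tmul_zero]

/-- **`μ : L ⊗_k A^Γ → A` is bijective** (Speiser's lemma / Galois descent for algebras).
[cite: SerreLocalFields1979, Ch. X, §2, Lemma 1] -/
theorem mulInvariants_bijective (hτ : IsSemilinear τ) : Function.Bijective (mulInvariants hτ) :=
  ⟨mulInvariants_injective hτ, mulInvariants_surjective hτ⟩

/-- **Galois descent for algebras**: the `L`-algebra isomorphism `L ⊗_k A^Γ ≃ A` for a semilinear
action of `Gal(L/k)` on the `L`-algebra `A` (Serre, *Local Fields*, X §2, Lemma 1; Görtz–Wedhorn I,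
Thm. 14.83 (affine case)). [cite: SerreLocalFields1979, Ch. X, §2, Lemma 1] -/
def descentEquiv (hτ : IsSemilinear τ) : L ⊗[k] (invariants hτ) ≃ₐ[L] A :=
  AlgEquiv.ofBijective (mulInvariants hτ) (mulInvariants_bijective hτ)

/-- Unfolding `descentEquiv` on pure tensors. [folklore] -/
@[simp]
theorem descentEquiv_tmul (hτ : IsSemilinear τ) (l : L) (a : invariants hτ) :
    descentEquiv hτ (l ⊗ₜ a) = l • (a : A) := by
  simp [descentEquiv]

/-- **Pushout form of Galois descent.** Let `B` be a `k`-algebra with a `k`-algebra structure map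
`B → A` which is injective with image exactly the invariants `A^Γ`. Then
`A = L ⊗_k B`, i.e. `Algebra.IsPushout k L B A` (the input of Mathlib's
`CommRingCat.isPushout_of_isPushout` and `AlgebraicGeometry.isPullback_SpecMap_of_isPushout`).
[cite: SerreLocalFields1979, Ch. X, §2, Lemma 1] [cite: GortzWedhorn2020, Thm. 14.83] -/
theorem isPushout_of_invariants (hτ : IsSemilinear τ) {B : Type*} [CommRing B] [Algebra k B]
    [Algebra B A] [IsScalarTower k B A] (hinj : Function.Injective (algebraMap B A))
    (hrange : Set.range (algebraMap B A) = {a | ∀ σ, τ σ a = a}) : Algebra.IsPushout k L B A := by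
  -- `B ≃ A^Γ` as `k`-algebras
  have hmem : ∀ x : B, algebraMap B A x ∈ invariants hτ := fun x ↦ by
    have hx : algebraMap B A x ∈ Set.range (algebraMap B A) := ⟨x, rfl⟩
    rw [hrange] at hx
    exact (mem_invariants hτ).mpr hx
  let e₀ : B →ₐ[k] invariants hτ :=
    (IsScalarTower.toAlgHom k B A).codRestrict (invariants hτ) hmem
  have he₀ : Function.Bijective e₀ := by
    refine ⟨fun x y hxy ↦ hinj (congrArg Subtype.val hxy), fun ⟨a, ha⟩ ↦ ?_⟩
    have : a ∈ Set.range (algebraMap B A) := by rw [hrange]; exact ha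
    obtain ⟨x, rfl⟩ := this
    exact ⟨x, rfl⟩
  let e : B ≃ₐ[k] invariants hτ := AlgEquiv.ofBijective e₀ he₀
  -- the composite `L ⊗ B ≃ L ⊗ A^Γ ≃ A`
  let E : L ⊗[k] B ≃ₗ[L] A :=
    (Algebra.TensorProduct.congr (AlgEquiv.refl : L ≃ₐ[L] L) e).toLinearEquiv.trans
      (descentEquiv hτ).toLinearEquiv
  refine ⟨IsBaseChange.of_equiv E fun x ↦ ?_⟩
  change descentEquiv hτ (Algebra.TensorProduct.congr AlgEquiv.refl e (1 ⊗ₜ x)) = algebraMap B A x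
  rw [Algebra.TensorProduct.congr_apply, Algebra.TensorProduct.map_tmul, descentEquiv_tmul]
  simp [e, e₀]

end GaloisDescentAlgebras

end Literature.RingTheory.GaloisAlgebras
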